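import Mathlib
import HarnessLib
import Summits.Ventures.LatticeQCDFlow.Scoring.DoeblinCrossCovariance
import Summits.Ventures.LatticeQCDFlow.Exactness.DoeblinAutocovariance

/-!
# The `m`-skeleton envelope: a Markov kernel whose `m`-step iterate is minorised by the invariant
# law has `|C_f(mq + r)| ≤ (1 − ε)^q Var_π f` and `τ_int(f) ≤ m/ε − 1/2`

HONEST FRAMING: exact (Metropolis-corrected) sampling algorithms for lattice gauge theory;
figures of merit are autocorrelation/cost numbers at stated couplings and volumes; no
continuum-physics claim.

Venture `LatticeQCDFlow` (cell pub-lqcd), topic `Scoring`; FANOUT row 8 (`s0-cpn-nemc`, GEN-12).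
NEW WORK of the cell, not a published result: the envelope of `Scoring/DoeblinAutocorrelation.lean`
(`|C_f(t)| ≤ (1 − ε)ᵗ Var_π f`, `τ_int ≤ 1/ε − 1/2` under ONE-STEP Doeblin by `π`) assumed only for
the `m`-STEP kernel — the form in which a minorisation is usually available for a sweep, a
trajectory or a block of updates (one step of a deterministic-scan or local sampler typically
minorises nothing).  Inputs: the bilinear envelope of `Scoring/DoeblinCrossCovariance.lean`
(`abs_integral_mul_iterate_kop_le_of_doeblin`), the groundwork of
`Scoring/KernelTransitionOperator.lean` / `Scoring/DoeblinAutocorrelation.lean`, and row 9's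
iterate `Exactness.nHit κ m = κ ∘ₖ ⋯ ∘ₖ κ` (`Exactness/InvariantComposition.lean`: `invariant_nHit`;
`Exactness/DoeblinAutocovariance.lean`: `isMarkovKernel_nHit`).  Published input: only the residual
kernel of the tree's Doeblin formalisation through the parent files; nothing is restated or cited as
a fact.  Printed counterpart, NAMED ONLY: the `m`-skeleton / "small set in `m` steps" form of the
Doeblin–Doob minorisation and its rate `(1 − ε)^{⌊t/m⌋}` (Meyn–Tweedie 1993 Thm 16.0.2 / 16.2.4;
Rosenthal 1995, *Minorization conditions and convergence rates for MCMC*, named only).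

## Content (`κ` Markov, invariant probability law `π`; `m`-STEP DOEBLIN BY `π`:
## `(nHit κ m)(x, B) ≥ ε π(B)`; `f` bounded measurable `π`-centred)

* `nHit_eq_pow` — row 9's iterate is Mathlib's monoid power, `nHit κ n = κ ^ n` (so the hypothesis
  reads `κ ^ m ≥ ε π`, the shape of Mathlib's `Kernel.IsIrreducible`); `doeblin_nHit_succ_of_doeblin`
  — a one-step constant is an `m`-step constant for every `m ≥ 1` (the converse fails: that is the
  point);
* `kop_id`, **`kop_nHit`** — `kop (nHit κ n) g = (kop κ)^[n] g`; `iterate_kop_nHit` —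
  `(kop (nHit κ m))^[q] g = (kop κ)^[m q] g` (Chapman–Kolmogorov on observables, iterated);
* **`abs_autocov_le_of_doeblin_nHit`** — THE `m`-SKELETON ENVELOPE:
  `|∫ f · (kop κ)^[m q + r] f dπ| ≤ (1 − ε)^q · ∫ f² dπ` for all `q, r` (write the lag as `m q + r`,
  peel `r` plain steps — an `L²(π)` contraction — and apply the bilinear one-step envelope to the
  skeleton kernel `nHit κ m`, whose invariant law is `π`); `abs_acf_le_of_doeblin_nHit` —
  `|ρ_f(t)| ≤ (1 − ε)^{⌊t/m⌋}`;
* `sum_range_mul_pow_div`, `summable_pow_div`, `tsum_pow_div_le`, `tsum_pow_succ_div_le` — the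
  comparison series: `Σ_{t<mQ} x^{⌊t/m⌋} = m Σ_{q<Q} x^q`, so `Σ_{t≥0} x^{⌊t/m⌋} ≤ m/(1 − x)` and
  `Σ_{t≥1} x^{⌊t/m⌋} ≤ m/(1 − x) − 1` for `0 ≤ x < 1`, `m ≥ 1`;
* **`tauInt_le_of_doeblin_nHit`** — on the tree's `Scoring.tauInt`: `τ_int(f) ≤ m/ε − 1/2` for
  every bounded measurable centred observable (`ε > 0`, `m ≥ 1`; the autocorrelation series is
  absolutely summable, `summable_acf_of_doeblin_nHit`); `tauInt_le_of_doeblin_pow` — the same with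
  the hypothesis written `κ ^ m ≥ ε π`; **`tauInt_le_exp_of_doeblin_nHit`** — with `ε = e^{−M}`:
  `τ_int(f) ≤ m e^{M} − 1/2`.

Reading (value-free): the unit of `τ_int` here is ONE application of `κ`; a certificate obtained for
a block of `m` updates costs the factor `m` and nothing else — `τ_int ≤ m/ε_m − 1/2` against
`1/ε₁ − 1/2`, and `ε_m` may be of order one where `ε₁ = 0`.  For the lazy kernel of
`Scoring/DoeblinEnvelopeSharp.lean` (`ε_m = 1 − (1 − ε)^m ≤ m ε`) the one-step bound is the better
one, so neither form dominates.  NOT CLAIMED: any constant of ours; which `m` is right for a given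
sampler (measured / row 9's heat-bath files); reversibility improvements; unbounded observables.
-/

noncomputable section

namespace Summit.Ventures.LatticeQCDFlow.Scoring

open MeasureTheory ProbabilityTheory Filter Finset Literature.Probability.MarkovChains
open Summit.Ventures.LatticeQCDFlow.Exactness
open scoped ENNReal

variable {Ω : Type*} [MeasurableSpace Ω]

/-! ### The skeleton kernel `nHit κ m` and its transition operator -/

section Skeleton

variable (κ : Kernel Ω Ω)

/-- Row 9's iterate is Mathlib's monoid power of kernels: `nHit κ n = κ ^ n`. -/
theorem nHit_eq_pow : ∀ n : ℕ, nHit κ n = κ ^ n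
  | 0 => by rw [nHit_zero, pow_zero]; rfl
  | n + 1 => by rw [nHit_succ, pow_succ', nHit_eq_pow n]; rfl

variable [IsMarkovKernel κ]

/-- `kop` of the identity kernel is the identity on measurable observables. -/
theorem kop_id {g : Ω → ℝ} (hg : Measurable g) : kop (Kernel.id : Kernel Ω Ω) g = g := by
  funext x
  unfold kop
  rw [Kernel.id_apply, integral_dirac' _ _ hg.stronglyMeasurable]

/-- **Chapman–Kolmogorov on observables, iterated**: `kop (nHit κ n) g = (kop κ)^[n] g` for bounded
measurable `g`. -/
theorem kop_nHit {C : ℝ} : ∀ (n : ℕ) {g : Ω → ℝ}, Measurable g → (∀ x, |g x| ≤ C) →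
    kop (nHit κ n) g = (kop κ)^[n] g
  | 0, g, hg, _ => by rw [nHit_zero, kop_id hg, Function.iterate_zero, id]
  | n + 1, g, hg, hC => by
    haveI := isMarkovKernel_nHit κ n
    rw [nHit_succ, kop_comp (nHit κ n) κ hg hC, kop_nHit n (measurable_kop κ hg) (abs_kop_le κ hC),
      ← Function.iterate_succ_apply]

/-- `(kop (nHit κ m))^[q] g = (kop κ)^[m q] g` for bounded measurable `g`. -/
theorem iterate_kop_nHit (m : ℕ) {g : Ω → ℝ} (hg : Measurable g) {C : ℝ} (hC : ∀ x, |g x| ≤ C) :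
    ∀ q : ℕ, (kop (nHit κ m))^[q] g = (kop κ)^[m * q] g
  | 0 => by rw [Nat.mul_zero, Function.iterate_zero, Function.iterate_zero]
  | q + 1 => by
    obtain ⟨hm', hb'⟩ := iterate_kop_bounded_measurable κ hg hC (m * q)
    rw [Function.iterate_succ_apply', iterate_kop_nHit m hg hC q, kop_nHit κ m hm' hb',
      ← Function.iterate_add_apply, Nat.mul_succ, Nat.add_comm]

variable {κ} {π : Measure Ω} [IsProbabilityMeasure π] {ε : ℝ≥0∞}

omit [IsProbabilityMeasure π] in
/-- A one-step Doeblin constant is an `(m+1)`-step Doeblin constant (the last step alone minorises;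
the converse is false — that is the point of the skeleton form). -/
theorem doeblin_nHit_succ_of_doeblin
    (hmin : ∀ x {B : Set Ω}, MeasurableSet B → ε * π B ≤ κ x B) (m : ℕ) :
    ∀ x {B : Set Ω}, MeasurableSet B → ε * π B ≤ nHit κ (m + 1) x B := by
  intro x B hB
  haveI := isMarkovKernel_nHit κ m
  rw [nHit_succ, Kernel.comp_apply' _ _ _ hB]
  calc ε * π B = ∫⁻ _, ε * π B ∂(nHit κ m x) := by rw [lintegral_const, measure_univ, mul_one]
    _ ≤ ∫⁻ y, κ y B ∂(nHit κ m x) := lintegral_mono fun y => hmin y hB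

end Skeleton

/-! ### The `m`-skeleton envelope -/

section Envelope

variable {κ : Kernel Ω Ω} [IsMarkovKernel κ] {π : Measure Ω} [IsProbabilityMeasure π] {ε : ℝ≥0∞}
  {m : ℕ}

/-- **THE `m`-SKELETON ENVELOPE.**  If `π` is an invariant probability law of the Markov kernel `κ`
and the `m`-step kernel satisfies `(nHit κ m)(x, B) ≥ ε π(B)` for all `x` and measurable `B`, then for
every bounded measurable `π`-centred `f` and all `q, r`:
`|∫ f · (kop κ)^[m q + r] f dπ| ≤ (1 − ε)^q · ∫ f² dπ`. -/
theorem abs_autocov_le_of_doeblin_nHit (hπ : Kernel.Invariant κ π)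
    (hmin : ∀ x {B : Set Ω}, MeasurableSet B → ε * π B ≤ nHit κ m x B) {f : Ω → ℝ}
    (hf : Measurable f) {C : ℝ} (hC : ∀ x, |f x| ≤ C) (hf0 : ∫ x, f x ∂π = 0) (q r : ℕ) :
    |autocov κ π f (m * q + r)| ≤ (1 - ε.toReal) ^ q * ∫ x, f x ^ 2 ∂π := by
  haveI := isMarkovKernel_nHit κ m
  -- `u = (kop κ)^[r] f`: bounded, measurable, centred, `∫ u² ≤ ∫ f²`
  obtain ⟨hum, hub⟩ := iterate_kop_bounded_measurable κ hf hC r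
  have hu0 : ∫ x, (kop κ)^[r] f x ∂π = 0 := by rw [integral_iterate_kop κ hπ hf hC r, hf0]
  have hu2 : ∫ x, ((kop κ)^[r] f x) ^ 2 ∂π ≤ ∫ x, f x ^ 2 ∂π :=
    integral_sq_iterate_kop_le κ hπ hf hC r
  have hf2 : 0 ≤ ∫ x, f x ^ 2 ∂π := integral_nonneg fun x => sq_nonneg _
  -- the lag `m q + r` through the skeleton kernel
  have hlag : (kop κ)^[m * q + r] f = (kop (nHit κ m))^[q] ((kop κ)^[r] f) := by
    rw [Function.iterate_add_apply, iterate_kop_nHit κ m hum hub q]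
  have hbil := abs_integral_mul_iterate_kop_le_of_doeblin (κ := nHit κ m) (invariant_nHit hπ m)
    hmin hf hC hum hub hu0 q
  have hc0 : 0 ≤ 1 - ε.toReal := one_sub_toReal_nonneg_of_doeblin hmin
  unfold autocov
  rw [hlag]
  refine hbil.trans ?_
  refine mul_le_mul_of_nonneg_left ?_ (pow_nonneg hc0 q)
  calc Real.sqrt (∫ x, f x ^ 2 ∂π) * Real.sqrt (∫ x, ((kop κ)^[r] f x) ^ 2 ∂π)
      ≤ Real.sqrt (∫ x, f x ^ 2 ∂π) * Real.sqrt (∫ x, f x ^ 2 ∂π) :=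
        mul_le_mul_of_nonneg_left (Real.sqrt_le_sqrt hu2) (Real.sqrt_nonneg _)
    _ = ∫ x, f x ^ 2 ∂π := Real.mul_self_sqrt hf2

/-- In `ρ` form: `|C_f(m q + r)/C_f(0)| ≤ (1 − ε)^q` (trivial when `Var_π f = 0`). -/
theorem abs_acf_le_of_doeblin_nHit' (hπ : Kernel.Invariant κ π)
    (hmin : ∀ x {B : Set Ω}, MeasurableSet B → ε * π B ≤ nHit κ m x B) {f : Ω → ℝ}
    (hf : Measurable f) {C : ℝ} (hC : ∀ x, |f x| ≤ C) (hf0 : ∫ x, f x ∂π = 0) (q r : ℕ) :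
    |autocov κ π f (m * q + r) / autocov κ π f 0| ≤ (1 - ε.toReal) ^ q := by
  haveI := isMarkovKernel_nHit κ m
  have h := abs_autocov_le_of_doeblin_nHit hπ hmin hf hC hf0 q r
  have hc0 := one_sub_toReal_nonneg_of_doeblin hmin
  rw [autocov_zero]
  rcases (integral_nonneg fun x => sq_nonneg (f x) : 0 ≤ ∫ x, f x ^ 2 ∂π).eq_or_lt with hz | hpos
  · rw [← hz, div_zero, abs_zero]
    exact pow_nonneg hc0 q
  · rw [abs_div, abs_of_pos hpos, div_le_iff₀ hpos]
    exact h

/-- **`|ρ_f(t)| ≤ (1 − ε)^{⌊t/m⌋}`** for every lag `t` (Lean's `t / m`; for `m = 0` the exponent is `0`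
and the bound is Cauchy–Schwarz). -/
theorem abs_acf_le_of_doeblin_nHit (hπ : Kernel.Invariant κ π)
    (hmin : ∀ x {B : Set Ω}, MeasurableSet B → ε * π B ≤ nHit κ m x B) {f : Ω → ℝ}
    (hf : Measurable f) {C : ℝ} (hC : ∀ x, |f x| ≤ C) (hf0 : ∫ x, f x ∂π = 0) (t : ℕ) :
    |autocov κ π f t / autocov κ π f 0| ≤ (1 - ε.toReal) ^ (t / m) := by
  have h := abs_acf_le_of_doeblin_nHit' hπ hmin hf hC hf0 (t / m) (t % m)
  rwa [Nat.div_add_mod] at h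

end Envelope

/-! ### The comparison series `Σ_t x^{⌊t/m⌋}` -/

section Series

variable {x : ℝ} {m : ℕ}

/-- Block sums: `Σ_{t < m Q} x^{⌊t/m⌋} = m · Σ_{q < Q} x^q`. -/
theorem sum_range_mul_pow_div (x : ℝ) (hm : 0 < m) : ∀ Q : ℕ,
    ∑ t ∈ range (m * Q), x ^ (t / m) = m * ∑ q ∈ range Q, x ^ q
  | 0 => by simp
  | Q + 1 => by
    rw [Nat.mul_succ, Finset.sum_range_add, sum_range_mul_pow_div x hm Q, Finset.sum_range_succ,
      mul_add]
    congr 1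
    have h : ∀ s ∈ range m, x ^ ((m * Q + s) / m) = x ^ Q := fun s hs => by
      rw [Nat.mul_add_div hm, Nat.div_eq_of_lt (Finset.mem_range.1 hs), Nat.add_zero]
    rw [Finset.sum_congr rfl h, Finset.sum_const, Finset.card_range, nsmul_eq_mul]

/-- Partial sums of `x^{⌊t/m⌋}` are at most `m/(1 − x)` (`0 ≤ x < 1`, `m ≥ 1`). -/
theorem sum_range_pow_div_le (hm : 0 < m) (hx0 : 0 ≤ x) (hx1 : x < 1) (n : ℕ) :
    ∑ t ∈ range n, x ^ (t / m) ≤ m / (1 - x) := by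
  have hsub : range n ⊆ range (m * n) :=
    Finset.range_subset_range.2 (Nat.le_mul_of_pos_left n hm)
  have hgeo : ∑ q ∈ range n, x ^ q ≤ (1 - x)⁻¹ :=
    sum_le_hasSum (range n) (fun q _ => pow_nonneg hx0 q) (hasSum_geometric_of_lt_one hx0 hx1)
  calc ∑ t ∈ range n, x ^ (t / m) ≤ ∑ t ∈ range (m * n), x ^ (t / m) :=
        Finset.sum_le_sum_of_subset_of_nonneg hsub fun t _ _ => pow_nonneg hx0 _
    _ = m * ∑ q ∈ range n, x ^ q := sum_range_mul_pow_div x hm n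
    _ ≤ m * (1 - x)⁻¹ := mul_le_mul_of_nonneg_left hgeo (Nat.cast_nonneg m)
    _ = m / (1 - x) := (div_eq_mul_inv _ _).symm

/-- `t ↦ x^{⌊t/m⌋}` is summable (`0 ≤ x < 1`, `m ≥ 1`). -/
theorem summable_pow_div (hm : 0 < m) (hx0 : 0 ≤ x) (hx1 : x < 1) :
    Summable fun t : ℕ => x ^ (t / m) :=
  summable_of_sum_range_le (fun _ => pow_nonneg hx0 _) (sum_range_pow_div_le hm hx0 hx1)

/-- `Σ_{t ≥ 0} x^{⌊t/m⌋} ≤ m/(1 − x)`. -/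
theorem tsum_pow_div_le (hm : 0 < m) (hx0 : 0 ≤ x) (hx1 : x < 1) :
    ∑' t : ℕ, x ^ (t / m) ≤ m / (1 - x) :=
  Real.tsum_le_of_sum_range_le (fun _ => pow_nonneg hx0 _) (sum_range_pow_div_le hm hx0 hx1)

/-- `Σ_{t ≥ 1} x^{⌊t/m⌋} ≤ m/(1 − x) − 1` (the `t = 0` term is `1`). -/
theorem tsum_pow_succ_div_le (hm : 0 < m) (hx0 : 0 ≤ x) (hx1 : x < 1) :
    ∑' t : ℕ, x ^ ((t + 1) / m) ≤ m / (1 - x) - 1 := by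
  have hs := summable_pow_div hm hx0 hx1
  have h0 := hs.tsum_eq_zero_add
  rw [Nat.zero_div, pow_zero] at h0
  have h := tsum_pow_div_le hm hx0 hx1
  linarith

end Series

/-! ### `τ_int ≤ m/ε − 1/2` -/

section TauInt

variable {κ : Kernel Ω Ω} [IsMarkovKernel κ] {π : Measure Ω} [IsProbabilityMeasure π] {ε : ℝ≥0∞}
  {m : ℕ}

/-- Under an `m`-step Doeblin constant `ε > 0` (`m ≥ 1`) the autocorrelation series of every bounded
measurable centred observable is absolutely summable. -/
theorem summable_acf_of_doeblin_nHit (hπ : Kernel.Invariant κ π)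
    (hmin : ∀ x {B : Set Ω}, MeasurableSet B → ε * π B ≤ nHit κ m x B) (hm : 0 < m) (hε0 : 0 < ε)
    {f : Ω → ℝ} (hf : Measurable f) {C : ℝ} (hC : ∀ x, |f x| ≤ C) (hf0 : ∫ x, f x ∂π = 0) :
    Summable fun t : ℕ => autocov κ π f (t + 1) / autocov κ π f 0 := by
  haveI := isMarkovKernel_nHit κ m
  have hε1 := eps_le_one_of_doeblin hmin
  have hεr0 : 0 < ε.toReal :=
    ENNReal.toReal_pos hε0.ne' (ne_top_of_le_ne_top ENNReal.one_ne_top hε1)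
  have hl0 : 0 ≤ 1 - ε.toReal := one_sub_toReal_nonneg_of_doeblin hmin
  have hl1 : 1 - ε.toReal < 1 := by linarith
  have hs := (summable_nat_add_iff 1).2 (summable_pow_div (x := 1 - ε.toReal) hm hl0 hl1)
  exact Summable.of_norm_bounded hs fun t => by
    rw [Real.norm_eq_abs]; exact abs_acf_le_of_doeblin_nHit hπ hmin hf hC hf0 (t + 1)

/-- **`τ_int(f) ≤ m/ε − 1/2`** on the tree's `Scoring.tauInt`, for every bounded measurable
`π`-centred observable of a Markov kernel `κ` with invariant probability law `π` whose `m`-step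
kernel satisfies `(nHit κ m)(x, ·) ≥ ε π` (`ε > 0`, `m ≥ 1`); the unit of time is ONE application of
`κ`. -/
theorem tauInt_le_of_doeblin_nHit (hπ : Kernel.Invariant κ π)
    (hmin : ∀ x {B : Set Ω}, MeasurableSet B → ε * π B ≤ nHit κ m x B) (hm : 0 < m) (hε0 : 0 < ε)
    {f : Ω → ℝ} (hf : Measurable f) {C : ℝ} (hC : ∀ x, |f x| ≤ C) (hf0 : ∫ x, f x ∂π = 0) :
    tauInt (fun t => autocov κ π f t / autocov κ π f 0) ≤ m / ε.toReal - 1 / 2 := by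
  haveI := isMarkovKernel_nHit κ m
  have henv := fun t => abs_acf_le_of_doeblin_nHit hπ hmin hf hC hf0 t
  have hε1 := eps_le_one_of_doeblin hmin
  have hεr0 : 0 < ε.toReal :=
    ENNReal.toReal_pos hε0.ne' (ne_top_of_le_ne_top ENNReal.one_ne_top hε1)
  have hl0 : 0 ≤ 1 - ε.toReal := one_sub_toReal_nonneg_of_doeblin hmin
  have hl1 : 1 - ε.toReal < 1 := by linarith
  have hmaj := (summable_nat_add_iff 1).2 (summable_pow_div (x := 1 - ε.toReal) hm hl0 hl1)
  have hsum := summable_acf_of_doeblin_nHit hπ hmin hm hε0 hf hC hf0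
  have hle : ∑' t : ℕ, autocov κ π f (t + 1) / autocov κ π f 0
      ≤ ∑' t : ℕ, (1 - ε.toReal) ^ ((t + 1) / m) :=
    Summable.tsum_le_tsum (fun t => (le_abs_self _).trans (henv (t + 1))) hsum hmaj
  have htail := tsum_pow_succ_div_le (x := 1 - ε.toReal) hm hl0 hl1
  rw [sub_sub_cancel] at htail
  unfold tauInt
  linarith

/-- The same with the hypothesis written on Mathlib's kernel power: `(κ ^ m)(x, ·) ≥ ε π`. -/
theorem tauInt_le_of_doeblin_pow (hπ : Kernel.Invariant κ π)
    (hmin : ∀ x {B : Set Ω}, MeasurableSet B → ε * π B ≤ (κ ^ m) x B) (hm : 0 < m) (hε0 : 0 < ε)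
    {f : Ω → ℝ} (hf : Measurable f) {C : ℝ} (hC : ∀ x, |f x| ≤ C) (hf0 : ∫ x, f x ∂π = 0) :
    tauInt (fun t => autocov κ π f t / autocov κ π f 0) ≤ m / ε.toReal - 1 / 2 := by
  rw [← nHit_eq_pow] at hmin
  exact tauInt_le_of_doeblin_nHit hπ hmin hm hε0 hf hC hf0

/-- **`τ_int(f) ≤ m e^{M} − 1/2`** — the `m`-skeleton bound with the constant written `e^{−M}` (the
shape in which log-weight / action-difference oscillation bounds deliver a minorisation). -/
theorem tauInt_le_exp_of_doeblin_nHit (hπ : Kernel.Invariant κ π) {M : ℝ}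
    (hmin : ∀ x {B : Set Ω}, MeasurableSet B →
      ENNReal.ofReal (Real.exp (-M)) * π B ≤ nHit κ m x B) (hm : 0 < m)
    {f : Ω → ℝ} (hf : Measurable f) {C : ℝ} (hC : ∀ x, |f x| ≤ C) (hf0 : ∫ x, f x ∂π = 0) :
    tauInt (fun t => autocov κ π f t / autocov κ π f 0) ≤ m * Real.exp M - 1 / 2 := by
  have h := tauInt_le_of_doeblin_nHit hπ hmin hm (ENNReal.ofReal_pos.2 (Real.exp_pos _)) hf hC hf0
  have h1 : (m : ℝ) / (ENNReal.ofReal (Real.exp (-M))).toReal = m * Real.exp M := by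
    rw [ENNReal.toReal_ofReal (Real.exp_pos _).le, Real.exp_neg, div_inv_eq_mul]
  rw [h1] at h
  exact h

/-- … and the envelope in that shape: `|ρ_f(t)| ≤ (1 − e^{−M})^{⌊t/m⌋}`. -/
theorem abs_acf_le_exp_of_doeblin_nHit (hπ : Kernel.Invariant κ π) {M : ℝ}
    (hmin : ∀ x {B : Set Ω}, MeasurableSet B →
      ENNReal.ofReal (Real.exp (-M)) * π B ≤ nHit κ m x B)
    {f : Ω → ℝ} (hf : Measurable f) {C : ℝ} (hC : ∀ x, |f x| ≤ C) (hf0 : ∫ x, f x ∂π = 0)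
    (t : ℕ) : |autocov κ π f t / autocov κ π f 0| ≤ (1 - Real.exp (-M)) ^ (t / m) := by
  have h := abs_acf_le_of_doeblin_nHit hπ hmin hf hC hf0 t
  rwa [ENNReal.toReal_ofReal (Real.exp_pos _).le] at h

end TauInt

end Summit.Ventures.LatticeQCDFlow.Scoring

end
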